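import Summits.ResolutionOfSingularities.ResolutionOfSingularities.Theorems.WeightedInvariantWeightedConstructionCobordantBlowupRegular
import Summits.ResolutionOfSingularities.ResolutionOfSingularities.Theorems.WeightedInvariantRegularSubschemeCentre
import Summits.ResolutionOfSingularities.ResolutionOfSingularities.Theorems.WeightedInvariantHypersurfaceAdmissibleSequences
import HarnessLib

/-!
# Products of regular weighted centres with disjoint supports

Route `ResolutionOfSingularities/WeightedInvariant`, door crux `HypersurfaceCentreConstruction`
(stmt-ResolutionOfSingularities-19897), helper (summit-side, OURS) for centre choices supported on FINITELY MANY DISJOINT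
pieces (e-ladder rung `e = 1`, plan L2 «the product over the finitely many singular orbits of the orbit-wise centres is an
admissible centre»; any multi-component centre rule):

* `mem_support_piece_iff_of_isWeightedChart`, `support_piece_eq_support` — for a regular weighted centre every positive-degree piece has support equal to the support
  of the centre (on a chart, `(u^α : Σ wᵢαᵢ ≥ n)` vanishes exactly on `V(u)`: it contains `uᵢⁿ`);
* `ideal_piece_eq_top_of_forall_not_mem_support` — off its support the pieces of a regular weighted centre have unit sections;
* `isRegularWeightedCentre_of_piece_eq_mul` — if `R₁`, `R₂` are regular weighted centres with DISJOINT supports and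
  `Rₙ = (R₁)ₙ · (R₂)ₙ` for all `n`, then `R` is a regular weighted centre (near a point off `Supp R₂` the chart of `R₁`
  restricted to an affine neighbourhood missing `Supp R₂`, where `(R₂)ₙ = (1)`), with `support_of_piece_eq_mul`:
  `Supp R = Supp R₁ ∪ Supp R₂`;
* `isAdmissibleCentre_of_piece_eq_mul` — admissible centres (`IsAdmissibleCentre f X`: `(iii-a)`, `(iii-b′)`, `(hom)`) with
  disjoint supports have an admissible product (`(hom)` by `Ideal.IsHomogeneous.mul`);
* `isAdmissibleCentre_of_piece_eq_finsetProd` — finite products over pairwise disjoint supports (induction; support = union).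

Def-free (the product is any `R` with the stated pieces). AI-written; weaker than expert review.
References: J. Włodarczyk, arXiv:2203.03090, 2.1.10–2.1.12 [Wlodarczyk2022].
-/

noncomputable section

open CategoryTheory AlgebraicGeometry TopologicalSpace IsLocalRing
open Literature.AlgebraicGeometry.Resolution

set_option linter.dupNamespace false -- mandated namespace of this single-conjunct summit

namespace Summit.ResolutionOfSingularities.ResolutionOfSingularities.Theorems

universe u

section Support

variable {Y : Scheme.{u}} {R : ReesAlgebraData Y}

/-- On a weighted chart, a point of the chart lies in the support of the POSITIVE piece `Rₙ` iff all parameters vanish there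
(the piece contains `uᵢⁿ`, of weight `n·wᵢ ≥ n`). [cite: Wlodarczyk2022, Lemma 2.1.12] -/
theorem mem_support_piece_iff_of_isWeightedChart {U : Y.affineOpens} {m : ℕ} {u : Fin m → Γ(Y, U)} {w : Fin m → ℕ}
    (h : R.IsWeightedChart U u w) {n : ℕ} (hn : 0 < n) {y : Y} (hy : y ∈ (U : Y.Opens)) :
    y ∈ (R.piece n).support ↔ ∀ i, y ∉ Y.basicOpen (u i) := by
  constructor
  · intro hmem i hi
    rw [Scheme.IdealSheafData.mem_support_iff_of_mem hy, Scheme.mem_zeroLocus_iff] at hmem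
    have hui : u i ^ n ∈ (R.piece n).ideal U := by
      rw [h.ideal_eq n]
      refine Ideal.subset_span ⟨Pi.single i n, ?_, ?_⟩
      · rw [Finset.sum_eq_single i (fun j _ hj => by simp [hj]) (fun hi => absurd (Finset.mem_univ i) hi)]
        simpa using Nat.le_mul_of_pos_left n (h.w_pos i)
      · rw [Finset.prod_eq_single i (fun j _ hj => by simp [hj]) (fun hi => absurd (Finset.mem_univ i) hi)]
        simp
    exact hmem _ hui (by rw [Y.basicOpen_pow _ hn]; exact hi)
  · intro hall
    exact (R.mem_support_iff.mp ((ReesAlgebraData.IsWeightedChart.mem_support_iff R h hy).mpr hall)) n hn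

/-- **Every positive piece of a regular weighted centre has the support of the centre.** [cite: Wlodarczyk2022, 2.1.10] -/
theorem support_piece_eq_support (hR : R.IsRegularWeightedCentre) {n : ℕ} (hn : 0 < n) :
    ((R.piece n).support : Set Y) = R.support := by
  ext y
  obtain ⟨U, hyU, m, u, w, h⟩ := hR y
  rw [SetLike.mem_coe, mem_support_piece_iff_of_isWeightedChart h hn hyU,
    ReesAlgebraData.IsWeightedChart.mem_support_iff R h hyU]

/-- Off its support, the pieces of a regular weighted centre have unit ideals of sections on affine opens. [folklore] -/
theorem ideal_piece_eq_top_of_forall_not_mem_support (hR : R.IsRegularWeightedCentre) (U : Y.affineOpens)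
    (hU : ∀ y ∈ (U : Y.Opens), y ∉ R.support) (n : ℕ) : (R.piece n).ideal U = ⊤ := by
  rcases Nat.eq_zero_or_pos n with rfl | hn
  · rw [R.piece_zero]; rfl
  · refine ideal_eq_top_of_forall_not_mem_support (R.piece n) U fun y hy hmem => hU y hy ?_
    rw [← support_piece_eq_support hR hn]
    exact hmem

end Support

section Product

variable {Y : Scheme.{u}} {R₁ R₂ R : ReesAlgebraData Y}

/-- **The product of two regular weighted centres with disjoint supports is a regular weighted centre.** If `Rₙ = (R₁)ₙ·(R₂)ₙ`
for all `n` and `Supp R₁ ∩ Supp R₂ = ∅`, then around a point off `Supp R₂` a weighted chart of `R₁`, restricted to an affine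
neighbourhood missing `Supp R₂` (where every `(R₂)ₙ` is the unit ideal), is a weighted chart of `R`; symmetrically off
`Supp R₁`. [cite: Wlodarczyk2022, 2.1.10] -/
theorem isRegularWeightedCentre_of_piece_eq_mul (hR : ∀ n, R.piece n = R₁.piece n * R₂.piece n)
    (h₁ : R₁.IsRegularWeightedCentre) (h₂ : R₂.IsRegularWeightedCentre)
    (hdisj : Disjoint R₁.support R₂.support) : R.IsRegularWeightedCentre := by
  -- the symmetric local statement
  have key : ∀ {S T : ReesAlgebraData Y}, (∀ n, R.piece n = S.piece n * T.piece n) →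
      S.IsRegularWeightedCentre → T.IsRegularWeightedCentre → ∀ y : Y, y ∉ T.support →
      ∃ U : Y.affineOpens, y ∈ (U : Y.Opens) ∧
        ∃ (m : ℕ) (u : Fin m → Γ(Y, U)) (w : Fin m → ℕ), R.IsWeightedChart U u w := by
    intro S T hST hS hT y hyT
    obtain ⟨U', hyU', m, u, w, hch⟩ := hS y
    -- an affine neighbourhood of `y` inside `U'` missing the (closed) support of `T`
    have hTc : IsClosed T.support :=
      isClosed_iInter fun n => isClosed_iInter fun _ => (T.piece n).support.isClosed
    have hopen : IsOpen ((U' : Set Y) ∩ T.supportᶜ) := U'.1.isOpen.inter hTc.isOpen_compl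
    obtain ⟨V, hV, hyV, hVsub⟩ := exists_isAffineOpen_mem_and_subset (X := Y) (x := y)
      (U := ⟨(U' : Set Y) ∩ T.supportᶜ, hopen⟩) ⟨hyU', hyT⟩
    let W : Y.affineOpens := ⟨V, hV⟩
    have hWU' : W ≤ U' := fun z hz => (hVsub hz).1
    have hWT : ∀ z ∈ (W : Y.Opens), z ∉ T.support := fun z hz => (hVsub hz).2
    have hchW := isWeightedChart_restrict hch W hWU'
    refine ⟨W, hyV, m, _, w, ⟨hchW.w_pos, fun n => ?_, hchW.linearIndependent⟩⟩
    rw [hST n, Scheme.IdealSheafData.ideal_mul, Pi.mul_apply, hchW.ideal_eq n,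
      ideal_piece_eq_top_of_forall_not_mem_support hT W hWT n, Ideal.mul_top]
  intro y
  by_cases hy : y ∈ R₂.support
  · have hy₁ : y ∉ R₁.support := fun h => Set.disjoint_left.mp hdisj h hy
    exact key (fun n => by rw [hR n, mul_comm]) h₂ h₁ y hy₁
  · exact key hR h₁ h₂ y hy

/-- The support of a positive piece of the product is the union of the supports. [folklore] -/
theorem support_piece_of_piece_eq_mul (hR : ∀ n, R.piece n = R₁.piece n * R₂.piece n)
    (h₁ : R₁.IsRegularWeightedCentre) (h₂ : R₂.IsRegularWeightedCentre) {n : ℕ} (hn : 0 < n) :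
    ((R.piece n).support : Set Y) = R₁.support ∪ R₂.support := by
  rw [hR n, Scheme.IdealSheafData.support_mul, Closeds.coe_sup, support_piece_eq_support h₁ hn,
    support_piece_eq_support h₂ hn]

/-- **The support of the product is the union of the supports.** [folklore] -/
theorem support_of_piece_eq_mul (hR : ∀ n, R.piece n = R₁.piece n * R₂.piece n)
    (h₁ : R₁.IsRegularWeightedCentre) (h₂ : R₂.IsRegularWeightedCentre) :
    R.support = R₁.support ∪ R₂.support := by
  ext y
  rw [R.mem_support_iff]
  constructor
  · intro h
    have h1 := h 1 Nat.one_pos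
    rwa [← SetLike.mem_coe, support_piece_of_piece_eq_mul hR h₁ h₂ Nat.one_pos] at h1
  · intro hy n hn
    rw [← SetLike.mem_coe, support_piece_of_piece_eq_mul hR h₁ h₂ hn]
    exact hy

end Product

/-! ## Admissible centres -/

/-- **Admissible centres with disjoint supports have an admissible product**: `(iii-a)` by
`isRegularWeightedCentre_of_piece_eq_mul`, `(iii-b′)` since the support is the union of the supports, `(hom)` since a product
of homogeneous ideals is homogeneous. [cite: Wlodarczyk2022, 2.1.10] -/
theorem isAdmissibleCentre_of_piece_eq_mul {k : Type} [Field k] {Y : Scheme.{0}} (f : Y ⟶ Spec (.of k))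
    (X : Y.IdealSheafData) {R₁ R₂ R : ReesAlgebraData Y} (hR : ∀ n, R.piece n = R₁.piece n * R₂.piece n)
    (h₁ : IsAdmissibleCentre f X R₁) (h₂ : IsAdmissibleCentre f X R₂)
    (hdisj : Disjoint R₁.support R₂.support) : IsAdmissibleCentre f X R := by
  refine ⟨isRegularWeightedCentre_of_piece_eq_mul hR h₁.1 h₂.1 hdisj, ?_, fun j W 𝒜 _ h0 hX n => ?_⟩
  · rw [support_of_piece_eq_mul hR h₁.1 h₂.1]
    exact Set.union_subset h₁.2.1 h₂.2.1
  · rw [hR n, Scheme.IdealSheafData.ideal_mul, Pi.mul_apply]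
    exact Ideal.IsHomogeneous.mul (h₁.2.2 j W 𝒜 h0 hX n) (h₂.2.2 j W 𝒜 h0 hX n)

/-! ## Finite products -/

section FiniteProduct

variable {k : Type} [Field k] {Y : Scheme.{0}} (f : Y ⟶ Spec (.of k)) (X : Y.IdealSheafData)

/-- **Finite products of admissible centres with pairwise disjoint supports are admissible.** For a finite family of
admissible centres `R i` (`i ∈ s`) with pairwise disjoint supports, every Rees algebra `R` with pieces
`Rₙ = ∏_{i ∈ s} (R i)ₙ` is an admissible centre, and its support is `⋃_{i ∈ s} Supp (R i)` (induction on `s` with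
`isAdmissibleCentre_of_piece_eq_mul`; the empty product is the unit centre). [cite: Wlodarczyk2022, 2.1.10] -/
theorem isAdmissibleCentre_of_piece_eq_finsetProd {ι : Type} (s : Finset ι) (R : ι → ReesAlgebraData Y)
    (hadm : ∀ i ∈ s, IsAdmissibleCentre f X (R i))
    (hdisj : ∀ i ∈ s, ∀ i' ∈ s, i ≠ i' → Disjoint (R i).support (R i').support)
    (P : ReesAlgebraData Y) (hP : ∀ n, P.piece n = ∏ i ∈ s, (R i).piece n) :
    IsAdmissibleCentre f X P ∧ P.support = ⋃ i ∈ s, (R i).support := by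
  classical
  induction s using Finset.induction_on generalizing P with
  | empty =>
    have hP' : ∀ n, P.piece n = ⊤ := fun n => by rw [hP n, Finset.prod_empty]; rfl
    have hsupp : P.support = ∅ := by
      ext y
      simp only [Set.mem_empty_iff_false, iff_false]
      intro hy
      have h1 := (P.mem_support_iff.mp hy) 1 Nat.one_pos
      rw [hP' 1, Scheme.IdealSheafData.support_top] at h1
      exact h1
    refine ⟨⟨?_, ?_, fun j W 𝒜 _ _ _ n => ?_⟩, by simp [hsupp]⟩
    · -- the unit centre: every point has the unit chart
      intro y
      obtain ⟨U, hyU, m, u, w, hch⟩ := ReesAlgebraData.isRegularWeightedCentre_unit (Y := Y) y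
      exact ⟨U, hyU, m, u, w, ⟨hch.w_pos, fun n => by rw [hP' n, ← ReesAlgebraData.unit_piece (Y := Y) n,
        hch.ideal_eq n], hch.linearIndependent⟩⟩
    · rw [hsupp]; exact Set.empty_subset _
    · rw [hP' n, Scheme.IdealSheafData.ideal_top]
      exact Ideal.IsHomogeneous.top 𝒜
  | insert a s ha ih =>
    -- the product over `s`
    let Q : ReesAlgebraData Y :=
      { piece := fun n => ∏ i ∈ s, (R i).piece n
        piece_zero := by
          rw [Finset.prod_eq_one fun i _ => (R i).piece_zero]
          rfl
        piece_mul_le := fun m n => by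
          rw [← Finset.prod_mul_distrib]
          exact Finset.prod_le_prod' fun i _ => (R i).piece_mul_le m n }
    have hQ := ih (fun i hi => hadm i (Finset.mem_insert_of_mem hi))
      (fun i hi i' hi' hne => hdisj i (Finset.mem_insert_of_mem hi) i' (Finset.mem_insert_of_mem hi') hne) Q
      (fun _ => rfl)
    have hPa : ∀ n, P.piece n = (R a).piece n * Q.piece n := fun n => by
      rw [hP n, Finset.prod_insert ha]
    have hdisj' : Disjoint (R a).support Q.support := by
      rw [hQ.2, Set.disjoint_iUnion₂_right]
      exact fun i hi => hdisj a (Finset.mem_insert_self a s) i (Finset.mem_insert_of_mem hi)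
        (fun h => ha (h ▸ hi))
    refine ⟨isAdmissibleCentre_of_piece_eq_mul f X hPa (hadm a (Finset.mem_insert_self a s)) hQ.1 hdisj', ?_⟩
    rw [support_of_piece_eq_mul hPa (hadm a (Finset.mem_insert_self a s)).1 hQ.1.1, hQ.2,
      Finset.set_biUnion_insert]

end FiniteProduct

end Summit.ResolutionOfSingularities.ResolutionOfSingularities.Theorems

end
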